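import Literature.Barriers.NavierStokesRegularity.SchefferSwitchedSingular
import Literature.Barriers.NavierStokesRegularity.NavierStokesInequalityGluingWeak
import Literature.Barriers.NavierStokesRegularity.NavierStokesInequalitySingularSolutionsProofs
import HarnessLib

/-!
# Scheffer's switched field is a weak NSI solution: discharge of the switching argument

Barrier-catalogue support file for `NavierStokesRegularity` (D-0021): the DISCHARGE of the
switching argument of Scheffer 1985, Lemma 2.3, in the simplified presentation of W. S. Ożański,
arXiv:1709.00602, §2 ("Sketch of the proof of Theorem 1", pp. 6–7), for both vendored
statements of the tree:

* `nsiSwitching_holds : NSISwitching` (`NavierStokesInequalitySwitching.lean`, public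
  `IsNSIBlock`), and
* `IsNSIBlock.switching_holds : IsNSIBlock.switching`
  (`NavierStokesInequalitySingularSolutionsProofs.lean`, where the historical name
  `IsNSIBlock.switching` is kept as an `abbrev` of `NSISwitching`; the same proof term).

Given a classical NSI block `(T, ν₀, τ, z, G, u)`, the witness is Scheffer's glued field
`𝔲 = Scheffer.glue T τ z u` (`SchefferSwitchedField.lean`) with its pressure function
`t ↦ p̃[𝔲(t)]`: it agrees with `u` on `[0,T)` and vanishes from `T₀ = T/(1-τ²)` on; it is a weak
solution of the Navier–Stokes inequality for every `ν ∈ [0, ν₀]` by the gluing principle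
`isWeakNSISolution_of_piecewise` (`NavierStokesInequalityGluing*.lean`) fed with the piecewise
data of `SchefferSwitchedPieces.lean` (covariance of the pointwise NSI, the drops (2.6), the
per-piece local energy inequality with boundary terms, the pressure class of the slices) and the
global integrability / energy bound of `SchefferSwitchedIntegrability.lean`; its slices are
`C^∞` with support in `G` and `(T₀, x₀)`, `x₀ = z/(1-τ)`, is a singular point
(`SchefferSwitchedSingular.lean`). As a corollary the barrier fact
`NavierStokesInequalitySingularSolution` (Scheffer 1985, Thm. 1.1 = Ożański 2020, Thm. 1.5)
follows from the existence of a block alone (`navierStokesInequalitySingularSolution_of_exists_isNSIBlock`).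

## References

* W. S. Ożański, *On weak solutions to the Navier–Stokes inequality with internal
  singularities*, arXiv:1709.00602 (2017), §2 pp. 6–7. [`Ozanski2017NSISingular`]
* V. Scheffer, *A solution to the Navier–Stokes inequality with an internal singularity*,
  Comm. Math. Phys. 101 (1985), 47–85, Lemma 2.3 (pp. 55–57). [`Scheffer1985`]
* W. S. Ożański, Comm. Math. Phys. 374 (2020), Def. 1.1, Thm. 1.5. [`Ozanski2019NSI`]
-/

noncomputable section

open MeasureTheory Set Function Filter Topology TopologicalSpace Metric Module
open scoped ENNReal InnerProductSpace RealInnerProductSpace ContDiff Laplacian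

namespace Literature.Barriers.NavierStokesRegularity

namespace IsNSIBlock

open Scheffer Literature.Analysis.FluidPDE

variable {T ν₀ τ : ℝ} {z : EuclideanSpace ℝ (Fin 3)} {G : Set (EuclideanSpace ℝ (Fin 3))}
  {u : ℝ → EuclideanSpace ℝ (Fin 3) → EuclideanSpace ℝ (Fin 3)}

/-- **Scheffer's glued field is a weak solution of the Navier–Stokes inequality** for every
`ν ∈ [0, ν₀]`, with its pressure function `t ↦ p̃[𝔲(t)]` (Ożański 2017, §2: "Thus letting
`𝔲(t) = u^{(j)}(t)` … we obtain a vector field that satisfies the claims of Theorem 1";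
Scheffer 1985, Lemma 2.3): the gluing principle `isWeakNSISolution_of_piecewise` applied to the
pieces `u^{(j)}`, their pressures `p̃[u^{(j)}]` and slice derivatives.
[cite: Ozanski2017NSISingular, §2 pp. 6–7] [cite: Scheffer1985, Lemma 2.3] -/
theorem isWeakNSISolution_glue (h : IsNSIBlock T ν₀ τ z G u) {ν : ℝ} (hν : ν ∈ Icc 0 ν₀) :
    IsWeakNSISolution ν (glue T τ z u) fun s => normalisedPressure (glue T τ z u s) := by
  have hmeasp : AEStronglyMeasurable (uncurry fun s => normalisedPressure (glue T τ z u s))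
      (volume.restrict ((positiveTimes : Opens (ℝ × EuclideanSpace ℝ (Fin 3))) :
        Set (ℝ × EuclideanSpace ℝ (Fin 3)))) := by
    rw [Function.uncurry_def]
    exact h.aestronglyMeasurable_pressure_glue.restrict
  refine isWeakNSISolution_of_piecewise (t := switchTime T τ) (T₀ := blowupTime T τ)
    (v := fun j => piece T τ z u j) (q := fun j s => normalisedPressure (piece T τ z u j s))
    (Gr := fun s x => fderiv ℝ (glue T τ z u s) x)
    (strictMono_switchTime h.T_pos h.τ_pos) (switchTime_zero T τ)
    (tendsto_switchTime h.τ_pos.le h.τ_lt_one) ?_ ?_ ?_ ?_ ?_ ?_ ?_ h.energy_glue h.integrableOn_glue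
    h.integrableOn_fderiv_glue hmeasp h.integrable_norm_glue_sq h.integrable_norm_glue_cube
    h.integrable_pressure_mul_norm_glue h.integrable_frobeniusNormSq_glue
  · -- agreement on the pieces
    intro j s hs
    have e := glue_eq_piece h.T_pos h.τ_pos z u hs
    exact ⟨e, by simp only [e], by simp only [e]⟩
  · -- vanishing from `T₀` on
    intro s hs
    have e := glue_eq_zero_of_le h.T_pos h.τ_pos h.τ_lt_one z u hs
    refine ⟨e, by simp only [e, normalisedPressure_zero], ?_⟩
    funext x
    simp only [e]
    exact fderiv_const_apply _
  · exact fun j s hs => (h.contDiff_piece_slice hs).of_le (by norm_cast)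
  · exact fun j s hs => h.isDivFree_piece (Ico_subset_Icc_self hs)
  · exact fun j x => h.norm_piece_succ_le j x
  · exact fun j φ hφ hφ0 => h.localEnergyIneq_piece hν j (hφ.mono le_top) hφ0
  · exact fun j s hs => ⟨h.memLp_normalisedPressure_piece (Ico_subset_Icc_self hs),
      fun ψ hψ => h.poisson_normalisedPressure_piece (Ico_subset_Icc_self hs) hψ⟩

end IsNSIBlock

open Scheffer Literature.Analysis.FluidPDE

/-- **Discharge of the switching principle (fact A of `NavierStokesInequalitySwitching`)**:
Scheffer 1985, Lemma 2.3 / Ożański 2017, §2. For every classical NSI block `(T, ν₀, τ, z, G, u)`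
the glued field `𝔲 = Scheffer.glue T τ z u` agrees with `u` on `[0,T)`, vanishes from
`T₀ = T/(1-τ²)` on, is a weak solution of the Navier–Stokes inequality with pressure `p̃[𝔲(·)]`
for every `ν ∈ [0, ν₀]`, has `C^∞` slices supported in `G` for all `t ≥ 0`, and is singular at
`(T₀, x₀)`, `x₀ = z/(1-τ)`. [cite: Scheffer1985, Lemma 2.3] [cite: Ozanski2017NSISingular, §2 pp. 6–7] -/
theorem nsiSwitching_holds : NSISwitching := by
  intro T ν₀ τ z G u h
  refine ⟨glue T τ z u, fun t ht => glue_eq_of_mem_Ico h.T_pos h.τ_pos z u ht,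
    fun t ht => glue_eq_zero_of_le h.T_pos h.τ_pos h.τ_lt_one z u ht,
    fun ν hν => h.isWeakNSISolution_glue hν,
    fun t _ => ⟨h.contDiff_glue_slice t, h.tsupport_glue_slice_subset t⟩,
    h.not_isRegularPoint_glue⟩

/-- **Discharge of `IsNSIBlock.switching`** — the switching argument under the historical name kept
in `NavierStokesInequalitySingularSolutionsProofs.lean` (an `abbrev` of `NSISwitching`; Scheffer
1985, Lemma 2.3; Ożański 2017, §2): definitionally `nsiSwitching_holds`.
[cite: Scheffer1985, Lemma 2.3] [cite: Ozanski2017NSISingular, §2 pp. 6–7] -/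
theorem IsNSIBlock.switching_holds : IsNSIBlock.switching :=
  nsiSwitching_holds

/-- **Scheffer's theorem from the existence of a block alone.** With the switching principle
discharged, the barrier fact `NavierStokesInequalitySingularSolution` (Scheffer 1985, Thm. 1.1;
Ożański 2020, Thm. 1.5) follows from fact B (`NSIBlockExists`: Ożański 2017, §4 Prop. 9 with §5;
Scheffer 1985, Lemmas 2.4, 3.3, 6.4). [cite: Ozanski2017NSISingular, §2 p. 7] -/
theorem navierStokesInequalitySingularSolution_of_nsiBlockExists (hB : NSIBlockExists) :
    NavierStokesInequalitySingularSolution :=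
  navierStokesInequalitySingularSolution_of_switching nsiSwitching_holds hB

/-- The same from the existence statement `exists_isNSIBlock` of
`NavierStokesInequalitySingularSolutionsProofs.lean` (an `abbrev` of `NSIBlockExists`), by the
accepted public assembly `navierStokesInequalitySingularSolution_of_switching`.
[cite: Ozanski2017NSISingular, §2 p. 7] -/
theorem navierStokesInequalitySingularSolution_of_exists_isNSIBlock (hB : exists_isNSIBlock) :
    NavierStokesInequalitySingularSolution :=
  navierStokesInequalitySingularSolution_of_switching nsiSwitching_holds hB

end Literature.Barriers.NavierStokesRegularity

end

/-! ## `_holds` aliases (appended 2026-08-28)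

The named fact(s) below are already theorems of the tree under a differently-cased `_holds` name; the exact-name `_holds`
alias records the discharge under the tree's naming convention (D-0026 bookkeeping: proof term =
the existing theorem, no statement or definition edited). -/

/-- `NSISwitching` is a theorem of the tree (`Literature.Barriers.NavierStokesRegularity.nsiSwitching_holds`). [cite: Ozanski2017NSISingular, §2 (pp. 6–7)] [cite: Scheffer1985, Lemma 2.3] -/
theorem _root_.Literature.Barriers.NavierStokesRegularity.NSISwitching_holds : _root_.Literature.Barriers.NavierStokesRegularity.NSISwitching :=
  _root_.Literature.Barriers.NavierStokesRegularity.nsiSwitching_holds
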